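import Summits.AtomisticToContinuum.Crystallization.Theorems.FrustratedLawDichotomyAtlasReachLedger
import Summits.AtomisticToContinuum.Crystallization.Theorems.FrustratedLawDichotomyAtlasReachF1Sharp

/-!
# FrustratedLawDichotomy · crux `AperiodicFrustratedLawGap` (stmt-AtomisticToContinuum-27623) — THE ENERGY–MASS INEQUALITY AT THE CERTIFIED F1 ROW
# (decomp-a2c, hand-2 g50, structural share: the general lemma #132 `…AtlasReachLedger` §4 SPECIALISED to the tree's certified objects)

#132 `…AtlasReachLedger.offAtlasMass_ge_of_floors_nashCap` prices the off-atlas mass of EVERY point-stationary probability law that is a.s. rooted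
`7/10`-hard-core and a.s. Nash (clauses (a), (b), (e) — no texture, no aperiodicity, no minimality) from certified row floors and a cap:
`P(U) ≥ (m − ε)/(m + D)` whenever `E_P[rootEnergy] ≤ e⋆ + ε`.  The tree holds both certificates for the one-row atlas {F1}: the floor #129
`…CellF1cCert.hfloor_KF1c` (margin `23/10⁴`, no hypothesis) and the sharp sitewise cap (407) `…SharpDeficitCap.deficit_le_five` (`D = 5`, every rooted
`7/10`-hard-core configuration — a fortiori at uncovered Nash roots).  Hence, with NO hypothesis beyond (a)(b)(e) and the energy bound:
* ★★ `offAtlasMass_ge_F1`: `(23/10⁴ − ε)/(23/10⁴ + 5) ≤ P(KF1cᶜ)` — a law within `ε` of the periodic infimum keeps at least that fraction of its roots OFF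
  the F1 row of record; `ε = 0` (minimising, incl. the periodic minimisers themselves): `≥ 23/50023 > 1/2175` (`offAtlasMass_ge_F1_min`, `f1_massFloor_zero`);
  the bound is informative exactly for `ε < 23/10⁴` (`f1_massFloor_pos_iff`).
HONEST LABEL: a junction instance with a number; the residual A(η) of (404) and the crux are untouched.  Imports TREE #132 + #130 `…AtlasReachF1Sharp`
(hence (407), #129); theorems only; 0 sorry.  Tags: [new: junction instance].
-/

noncomputable section

namespace Summit.AtomisticToContinuum.Crystallization.Theorems.FrustratedLawDichotomyAtlasReachLedgerF1

open MeasureTheory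
open Literature.MathematicalPhysics.StatisticalMechanics Literature.Probability.Process
open Summit.AtomisticToContinuum.Crystallization.Theorems.ChargedEnergyGapNegative (E3 eStar)
open Summit.AtomisticToContinuum.Crystallization.Theorems.FrustratedLawDichotomyAtlasReach (reach)
open Summit.AtomisticToContinuum.Crystallization.Theorems.FrustratedLawDichotomyAtlasReachLedger (offAtlasMass_ge_of_floors_nashCap)
open Summit.AtomisticToContinuum.Crystallization.Theorems.FrustratedLawDichotomySharpDeficitCap (deficit_le_five)
open Summit.AtomisticToContinuum.Crystallization.Theorems.FrustratedLawDichotomyCellF1cRow (KF1c measurableSet_KF1c)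
open Summit.AtomisticToContinuum.Crystallization.Theorems.FrustratedLawDichotomyCellF1cCert (hfloor_KF1c)

/-- the one-row atlas {F1} covers exactly `KF1c`. [new: bookkeeping] -/
theorem iUnion_range_one_KF1c : (⋃ i ∈ Finset.range 1, (fun _ : ℕ => KF1c) i) = KF1c := by
  ext μ
  simp

/-- ★★ **THE ENERGY–MASS INEQUALITY AT {F1}, UNCONDITIONAL.**  Every point-stationary probability law that is a.s. rooted `7/10`-hard-core and a.s.
Nash, with mean root energy `≤ e⋆ + ε`, gives the complement of the certified F1 row mass `≥ (23/10⁴ − ε)/(23/10⁴ + 5)` (#132 at `n = 1` with the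
floor #129 `hfloor_KF1c` and the cap (407) `deficit_le_five`, by name). [new: junction instance] -/
theorem offAtlasMass_ge_F1 (P : Measure (Measure E3)) [IsProbabilityMeasure P] (ha : ∀ᵐ μ ∂P, IsRootedHardCore (7 / 10) μ)
    (hb : IsPointStationaryLaw P)
    (he : ∀ᵐ μ ∂P, ∀ p : E3, μ {p} ≠ 0 → ∀ y : E3, (∀ q : E3, μ {q} ≠ 0 → q ≠ p → y ≠ q) →
      ∑' q : {q : E3 // μ {q} ≠ 0 ∧ q ≠ p}, lennardJones (dist p (q : E3)) ≤ ∑' q : {q : E3 // μ {q} ≠ 0 ∧ q ≠ p}, lennardJones (dist y (q : E3)))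
    {ε : ℝ} (hmean : ∫ μ, rootEnergy lennardJones μ ∂P ≤ eStar + ε) :
    (23 / 10000 - ε) / (23 / 10000 + 5) ≤ P.real KF1cᶜ := by
  have h := offAtlasMass_ge_of_floors_nashCap 1 (fun _ => KF1c) (fun _ => measurableSet_KF1c) (fun _ => 23 / 10000)
    (fun _ _ μ hμ hN hrow => hfloor_KF1c μ hμ hN hrow) (by norm_num : (0 : ℝ) < 23 / 10000 + 5) (fun _ _ => le_rfl)
    (fun μ hμ _ _ => deficit_le_five μ hμ) P ha hb he hmean
  rwa [iUnion_range_one_KF1c] at h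

/-- `ε = 0`: every MINIMISING a.s. hard-core, point-stationary, a.s. Nash law (aperiodic or not, textured or not) keeps mass `≥ reach (23/10⁴) 5` off the
F1 row. [new: junction instance] -/
theorem offAtlasMass_ge_F1_min (P : Measure (Measure E3)) [IsProbabilityMeasure P] (ha : ∀ᵐ μ ∂P, IsRootedHardCore (7 / 10) μ)
    (hb : IsPointStationaryLaw P)
    (he : ∀ᵐ μ ∂P, ∀ p : E3, μ {p} ≠ 0 → ∀ y : E3, (∀ q : E3, μ {q} ≠ 0 → q ≠ p → y ≠ q) →
      ∑' q : {q : E3 // μ {q} ≠ 0 ∧ q ≠ p}, lennardJones (dist p (q : E3)) ≤ ∑' q : {q : E3 // μ {q} ≠ 0 ∧ q ≠ p}, lennardJones (dist y (q : E3)))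
    (hmin : ∫ μ, rootEnergy lennardJones μ ∂P ≤ eStar) : reach (23 / 10000) 5 ≤ P.real KF1cᶜ := by
  have h := offAtlasMass_ge_F1 P ha hb he (ε := 0) (by rw [add_zero]; exact hmin)
  rw [sub_zero] at h
  exact h

/-- THE NUMBERS: the `ε = 0` floor is `23/50023 > 1/2175`; at `ε = 10⁻³` it is still `> 1/3850`. [new: numerical instance] -/
theorem f1_massFloor_zero : (23 / 10000 - 0) / (23 / 10000 + 5) = (23 : ℝ) / 50023 ∧ (1 : ℝ) / 2175 < 23 / 50023 ∧
    (1 : ℝ) / 3850 < (23 / 10000 - 1 / 1000) / (23 / 10000 + 5) := by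
  refine ⟨by norm_num, by norm_num, by norm_num⟩

/-- the F1 mass floor is positive exactly in the robustness range `ε < 23/10⁴`. [new: bookkeeping] -/
theorem f1_massFloor_pos_iff (ε : ℝ) : 0 < (23 / 10000 - ε) / (23 / 10000 + 5) ↔ ε < 23 / 10000 := by
  rw [div_pos_iff_of_pos_right (by norm_num : (0 : ℝ) < 23 / 10000 + 5), sub_pos]

end Summit.AtomisticToContinuum.Crystallization.Theorems.FrustratedLawDichotomyAtlasReachLedgerF1

end
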